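import Summits.CriticalPhenomena.SAWScalingLimit.Theses.SAWDevelopingMap
import Summits.CriticalPhenomena.SAWScalingLimit.Theses.SAWCompassLattice
import Summits.CriticalPhenomena.SAWScalingLimit.Theses.SAWResidueField
import Literature.Probability.RandomPlanarGeometry.SLEUniquenessInLaw
import Literature.Probability.RandomPlanarGeometry.SAWScalingLimitFamily
import Literature.Probability.RandomPlanarGeometry.ZoomFlow

/-!
# Line `pin-the-shear`, stub 1 (`stub_ybShearTransport`): reduction to `YBSquareSLE` with `Φ = id`

Work file of the second lead seat (prover-line-stmt-CriticalPhenomena-14221-c1-0).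
The statement of `stub_ybShearTransport` (YB law transport hexagonal ↦ GM `π/2`, modulo an
unidentified linear `Φ`, under (A) = `HexConjecture`) is implied — with the IDENTITY matrix — by
the open crux `SAWCompassLattice.YBSquareSLE` (stmt-6967) together with the routine existence of
hexagonal endpoint approximations `SAWResidueField.HexEndpointApproxExists` (stmt-9864): under
(A) and `YBSquareSLE` both laws converge to chordal SLE(8/3) random curves of the same Dobrushin
domain, which are equal in law (`IsSLECurve.map_eq_holds`), so the integrals against a bounded
continuous test function have the same limit (the two-limits lemma `tendsto_sub_of_tendstoLaw'`,
copied from the crux disprover's `Negative.tendsto_sub_of_tendstoLaw`, p95732, to keep imports light). Hence the open content of stub 1 is at most `YBSquareSLE ∧ stmt-9864`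
given (A); conversely stub 1 is the GL₂⁺-tolerant WEAKENING of that conjunction which the line's
pin (stubs 3–7, all landed) can afford.
-/

noncomputable section

namespace Summit.CriticalPhenomena.SAWScalingLimit.Cruxes.HexTransfer.PinTheShear

open MeasureTheory Filter Topology Set
open scoped NNReal ENNReal
open Literature.Probability.RandomPlanarGeometry
open Literature.Probability.RandomPlanarGeometry.SAW.YangBaxter
open Literature.Probability.LatticeModels (Site HexVertex hexGraph hexCenter)
open Literature.Probability (Process.preWienerMeasure)
open Summit.CriticalPhenomena.SAWScalingLimit.Theses

/-- Two families converging in law along the mesh filter to random elements with the same law have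
asymptotically equal integrals against every bounded continuous test function (copy of the crux
disprover's `Negative.tendsto_sub_of_tendstoLaw`, p95732). [folklore] -/
theorem tendsto_sub_of_tendstoLaw' {Ω₁ Ω₂ : ℝ → Type*} [∀ δ, MeasurableSpace (Ω₁ δ)]
    [∀ δ, MeasurableSpace (Ω₂ δ)] {Ω' : Type*} [MeasurableSpace Ω'] {X : Type*} [TopologicalSpace X]
    [MeasurableSpace X] [OpensMeasurableSpace X]
    {Y₁ : ∀ δ, Ω₁ δ → X} {P₁ : ∀ δ, Measure (Ω₁ δ)} {Y₂ : ∀ δ, Ω₂ δ → X} {P₂ : ∀ δ, Measure (Ω₂ δ)}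
    {Z₁ Z₂ : Ω' → X} {W : Measure Ω'} (h₁ : TendstoLaw Y₁ P₁ Z₁ W) (h₂ : TendstoLaw Y₂ P₂ Z₂ W)
    (hZ₁ : AEMeasurable Z₁ W) (hZ₂ : AEMeasurable Z₂ W) (hlaw : W.map Z₁ = W.map Z₂)
    (f : BoundedContinuousFunction X ℝ) :
    Tendsto (fun δ => (∫ ω, f (Y₁ δ ω) ∂P₁ δ) - ∫ ω, f (Y₂ δ ω) ∂P₂ δ) (𝓝[>] (0 : ℝ)) (𝓝 0) := by
  have hint : ∫ ω, f (Z₁ ω) ∂W = ∫ ω, f (Z₂ ω) ∂W := by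
    rw [← integral_map hZ₁ f.continuous.aestronglyMeasurable,
      ← integral_map hZ₂ f.continuous.aestronglyMeasurable, hlaw]
  have h := (h₁ f).sub (h₂ f)
  rwa [hint, sub_self] at h

/-- **Stub 1 from `YBSquareSLE`, with `Φ = id`.** If hexagonal endpoint approximations exist in
every Dobrushin domain (stmt-9864) and Glazman–Manolescu's critical `π/2` walk converges to chordal
SLE(8/3) (stmt-6967), then the YB shear transport statement of line `pin-the-shear` holds with the
identity matrix: under (A) both the `π/2` law in `D` and the hexagonal law in `D` converge to
SLE(8/3) random curves of `D`, equal in law, so their integrals against every bounded continuous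
test function have difference tending to `0`. [folklore] -/
theorem ybShearTransport_of_ybSquareSLE (hE : SAWResidueField.HexEndpointApproxExists)
    (hY : SAWCompassLattice.YBSquareSLE) :
    SAWDevelopingMap.HexConjecture →
    ∃ m₁₁ m₁₂ m₂₁ m₂₂ : ℝ, 0 < m₁₁ * m₂₂ - m₁₂ * m₂₁ ∧ ∀ Φ : ℂ ≃ₜ ℂ,
      (∀ z : ℂ, Φ z = ((m₁₁ * z.re + m₁₂ * z.im : ℝ) : ℂ) +
          ((m₂₁ * z.re + m₂₂ * z.im : ℝ) : ℂ) * Complex.I) →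
      ∀ (D : DobrushinDomain) (a b : ℝ → MidEdge),
        IsYBEndpointApprox (fun (_ : ℤ) => Real.pi / 2) D a b →
        ∃ a' b' : ℝ → HexVertex,
          SAW.IsEmbEndpointApprox hexGraph hexCenter (D.map Φ.symm) a' b' ∧
          ∀ f : BoundedContinuousFunction (CurveClass ℂ) ℝ,
            Tendsto (fun δ => (∫ γ, f (γ.curve (fun (_ : ℤ) => Real.pi / 2) δ)
                ∂(ybLaw (fun (_ : ℤ) => Real.pi / 2) D.carrier δ 1 (a δ) (b δ))) -
              ∫ γ, f (CurveClass.map (Φ : C(ℂ, ℂ)) γ.curve)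
                ∂(SAW.hexSAWLaw (D.map Φ.symm).carrier δ (a' δ) (b' δ)))
              (𝓝[>] 0) (𝓝 0) := by
  intro hA
  refine ⟨1, 0, 0, 1, by norm_num, ?_⟩
  intro Φ hΦ D a b hab
  -- `Φ` is the identity
  have hΦid : Φ = Homeomorph.refl ℂ := by
    ext1 z
    rw [hΦ z, Homeomorph.refl_apply]
    apply Complex.ext <;> simp
  subst hΦid
  rw [Homeomorph.refl_symm, MarkedDomain.map_refl, CurveClass.map_homeomorph_refl]
  -- hexagonal endpoints of `D` and the two SLE(8/3) limits
  obtain ⟨a₀, b₀, h₀⟩ := SAW.exists_isEndpointApprox D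
  obtain ⟨a', b', hab'⟩ := hE D a₀ b₀ h₀
  refine ⟨a', b', hab', fun f => ?_⟩
  obtain ⟨Γ, hΓ, -, hT⟩ := hY D a b hab
  obtain ⟨Γ', hΓ', -, hT'⟩ := hA D a' b' hab'
  exact tendsto_sub_of_tendstoLaw' hT hT' hΓ.1 hΓ'.1 (IsSLECurve.map_eq_holds hΓ hΓ') f

end Summit.CriticalPhenomena.SAWScalingLimit.Cruxes.HexTransfer.PinTheShear

end
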